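import Summits.HodgeConjecture.HodgeConjecture.Theorems.Ring2HypothesesDescentAlgebraicQuasiInverse
import Summits.HodgeConjecture.HodgeConjecture.Theorems.Ring2HypothesesDescentIdempotentCancellation
import HarnessLib

/-!
# Ring 2 hypotheses, descent face — CANCELLATION OF ALGEBRAIC IDEMPOTENTS UNDER `B(X)`: if `Hᵃ(X) = E₀ ⊕ E₁ ⊕ E₂` and
# `Hᶜ(X) = F₀ ⊕ F₁ ⊕ F₂` by algebraic idempotents, `Hᵃ ≅ Hᶜ`, `E₀ ≅ F₂`, `E₂ ≅ F₀` by algebraic correspondences, then an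
# ALGEBRAIC correspondence maps `F₁` injectively into `E₁` (the Morita corner over the semisimple correspondence algebra)

research route conditional on HC_CM; not a corollary; Q11.4-sentence-2 already refuted in dim ≥ 3.
Cell `pub-hodge-ring2` (Hodge ladder STAGE 3), seat `ring2-b05` (binder row b05 `Ring2.Hypotheses.MotivatedImpliesAlgebraicAV`,
published modulo X = `Ring2.AbelianAll.LefschetzBCompactPencils`), gen 47, third file. `HC_CM`
(`Theses.RankFourFaces.CMAbelianHodge`) does not occur in this file; `B(X)` is a displayed HYPOTHESIS throughout; nothing
here proves a case of the Hodge conjecture or of `B`; no binder is discharged; no node of the cell moves.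

PURPOSE. The gen-47 first file (`…LefschetzBMiddleBlock`) reduced `B⋆(𝒴)` for a compact abelian pencil to β-type fibre-class
inverses and the MIDDLE-BLOCK inverses (R₁), and proved the converse `B⋆(𝒴) ⟹ β`. The converse `B⋆(𝒴) ⟹ (R₁)` — needed to
make «β ∧ (R₁)» a NORMAL FORM of `B⋆(𝒴)` — asks for an algebraic correspondence injective on the middle Leray piece of
`H^{b+2r+2}(𝒴)` with values in the middle piece of `H^{b+2}(𝒴)`: NOT the inverse of the relative Lefschetz isomorphism
(a Hodge-theoretic object the carriers do not hold) but ANY algebraic injection, whose existence is a CANCELLATION statement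
about idempotents in the algebra of algebraic correspondences:

**`exists_algebraic_injective_middle_of_lefschetzB`** — for `X` smooth projective with `B⋆(X, η)` for all `η`, degrees
`a + 2(m+1) = c ≤ 2 dim X`, algebraic idempotents `e₀ ⊥ e₂` on `Hᵃ(X)` and `f₀ ⊥ f₂` on `Hᶜ(X)`, algebraic mutually inverse
`Φ : Hᵃ ⥲ Hᶜ`, `θ`, and algebraic Murray–von Neumann equivalences `a₀, b₀` (`range e₀ ≅ range f₂`) and `a₂, b₂`
(`range e₂ ≅ range f₀`): there is an ALGEBRAIC `x : Hᶜ(X) → Hᵃ(X)` killed by `e₀, e₂` on the left and by `f₀, f₂` on the right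
and INJECTIVE on `ker f₀ ∩ ker f₂`. Proof: gen 42's Morita corner — embed `Hᵃ(X)` (`i_*`, retraction `pr_{X*}`) and `Hᶜ(X)`
(`pr_X^*`, retraction `i^*`) into `Hᶜ(X × W)`, `W` an abelian variety of dimension `m + 1`; `B⋆(X × W)` (Lieberman + Kleiman
2.5, `standardConjectureBStar_tensor_abelianVariety_of_forall`); the operator algebra of `A^{dim}(Z ⊗ Z)_ℂ` on `Hᶜ(Z)` is
semisimple (gen 37, Jannsen) and finite-dimensional; transport the twelve data into it (thirty identities checked on vectors
with `pr_{X*} i_* = 1`, `i^* pr_X^* = 1`) and apply the second file's `exists_equivalent_middle_of_traces`.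

HONEST COLUMN. No definition, no named fact, no sorry; `HC_CM` absent; `B⋆` displayed, never asserted. A TOOL for the fourth file;
nothing on the cell's rows. References: Jannsen1992 (Thm. 1); Kleiman1968AlgebraicCycles (§2 Cor. 2.5, §3 Thm. 3.11);
Lieberman1968; BourbakiAlgebreVIII2012 (VIII §20 n°6 Cor. a) pp. 375–376); Andre1996Motifs (Prop. 3.3 pp. 21–22);
Fulton1998 (§16.1 Prop. 16.1.1); FultonYoungTableaux1997 (App. B §B.1 (1), (2), (5)).
-/

noncomputable section

-- every declaration of this problem lives in `Summit.HodgeConjecture.HodgeConjecture.…` (summit = sub-problem)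
set_option linter.dupNamespace false

open CategoryTheory AlgebraicGeometry MonoidalCategory CartesianMonoidalCategory
open Literature.AlgebraicGeometry Literature.AlgebraicGeometry.Motives Literature.AlgebraicGeometry.HodgeTheory
open Summit.HodgeConjecture.HodgeConjecture.Ring2.AbelianAll

namespace Summit.HodgeConjecture.HodgeConjecture.Theorems

/-! ## §2 The Morita corner: cancellation for algebraic idempotents on two degrees of `X` under `B(X)` -/

section Corner

variable {n : ℕ} {X : SchemeOver ℂ}

/-- **CANCELLATION OF ALGEBRAIC IDEMPOTENTS UNDER `B(X)`.** Let `X` be smooth projective of dimension `n` with `B⋆(X, η)` for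
every `η`, degrees `a + 2(m+1) = c ≤ 2n`, algebraic idempotents `e₀ ⊥ e₂` on `Hᵃ(X)` and `f₀ ⊥ f₂` on `Hᶜ(X)`, mutually inverse
algebraic `Φ : Hᵃ(X) ⥲ Hᶜ(X)`, `θ`, and algebraic Murray–von Neumann equivalences `a₀ ∈ f₂∘?∘e₀`, `b₀` (`b₀ a₀ = e₀`, `a₀ b₀ = f₂`)
and `a₂ ∈ f₀∘?∘e₂`, `b₂` (`b₂ a₂ = e₂`, `a₂ b₂ = f₀`). Then there is an ALGEBRAIC `x : Hᶜ(X) → Hᵃ(X)` with `e₀ x = e₂ x = 0`,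
`x f₀ = x f₂ = 0`, INJECTIVE on `ker f₀ ∩ ker f₂` — i.e. an algebraic injection of the middle summand `range (1 - f₀ - f₂)` into
the middle summand `range (1 - e₀ - e₂)`. Proof: gen 42's corner — `Z := X × W` (`W` abelian of dimension `m + 1`), `i_*` /
`pr_{X*}` and `pr_X^*` / `i^*` embed `Hᵃ(X)`, `Hᶜ(X)` into `Hᶜ(Z)` with algebraic retractions, `B⋆(Z)` (Lieberman, Kleiman 2.5), the
operator algebra of `A^{dim Z}(Z ⊗ Z)_ℂ` on `Hᶜ(Z)` is semisimple (Jannsen, gen 37) and finite-dimensional; transport the data and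
apply §1. [cite: Jannsen1992, Thm. 1] [cite: Kleiman1968AlgebraicCycles, §2 Cor. 2.5 and §3 Thm. 3.11] [cite: Lieberman1968, main theorem]
[cite: BourbakiAlgebreVIII2012, VIII § 20 n° 6, Cor. a) de la Prop. 6 (pp. 375–376)] -/
theorem exists_algebraic_injective_middle_of_lefschetzB (hX : IsSmoothProjective n X)
    (hB : ∀ η : complexBetti X 2, StandardConjectureBStar n X η) {a c m : ℕ} (hac : a + 2 * (m + 1) = c) (hc : c ≤ 2 * n)
    {e₀ e₂ : complexBetti X a →ₗ[ℂ] complexBetti X a} {f₀ f₂ : complexBetti X c →ₗ[ℂ] complexBetti X c}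
    (alge₀ : IsAlgebraicCorrespondence n n X X e₀) (alge₂ : IsAlgebraicCorrespondence n n X X e₂)
    (algf₀ : IsAlgebraicCorrespondence n n X X f₀) (algf₂ : IsAlgebraicCorrespondence n n X X f₂)
    (he₀ : ∀ v, e₀ (e₀ v) = e₀ v) (he₂ : ∀ v, e₂ (e₂ v) = e₂ v) (he₀₂ : ∀ v, e₀ (e₂ v) = 0) (he₂₀ : ∀ v, e₂ (e₀ v) = 0)
    (hf₀ : ∀ w, f₀ (f₀ w) = f₀ w) (hf₂ : ∀ w, f₂ (f₂ w) = f₂ w) (hf₀₂ : ∀ w, f₀ (f₂ w) = 0) (hf₂₀ : ∀ w, f₂ (f₀ w) = 0)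
    {Φ : complexBetti X a →ₗ[ℂ] complexBetti X c} {θ : complexBetti X c →ₗ[ℂ] complexBetti X a}
    (algΦ : IsAlgebraicCorrespondence n n X X Φ) (algθ : IsAlgebraicCorrespondence n n X X θ)
    (hθΦ : ∀ v, θ (Φ v) = v) (hΦθ : ∀ w, Φ (θ w) = w)
    {a₀ : complexBetti X a →ₗ[ℂ] complexBetti X c} {b₀ : complexBetti X c →ₗ[ℂ] complexBetti X a}
    (alga₀ : IsAlgebraicCorrespondence n n X X a₀) (algb₀ : IsAlgebraicCorrespondence n n X X b₀)
    (ha₀ : ∀ v, f₂ (a₀ (e₀ v)) = a₀ v) (hb₀ : ∀ w, e₀ (b₀ (f₂ w)) = b₀ w) (hba₀ : ∀ v, b₀ (a₀ v) = e₀ v)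
    (hab₀ : ∀ w, a₀ (b₀ w) = f₂ w)
    {a₂ : complexBetti X a →ₗ[ℂ] complexBetti X c} {b₂ : complexBetti X c →ₗ[ℂ] complexBetti X a}
    (alga₂ : IsAlgebraicCorrespondence n n X X a₂) (algb₂ : IsAlgebraicCorrespondence n n X X b₂)
    (ha₂ : ∀ v, f₀ (a₂ (e₂ v)) = a₂ v) (hb₂ : ∀ w, e₂ (b₂ (f₀ w)) = b₂ w) (hba₂ : ∀ v, b₂ (a₂ v) = e₂ v)
    (hab₂ : ∀ w, a₂ (b₂ w) = f₀ w) :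
    ∃ x : complexBetti X c →ₗ[ℂ] complexBetti X a, IsAlgebraicCorrespondence n n X X x ∧
      (∀ w, e₀ (x w) = 0) ∧ (∀ w, e₂ (x w) = 0) ∧ (∀ w, x (f₀ w) = 0) ∧ (∀ w, x (f₂ w) = 0) ∧
      ∀ w, f₀ w = 0 → f₂ w = 0 → x w = 0 → w = 0 := by
  have hPD := hasPoincareDuality_complexOrientationFamily
  -- the auxiliary variety `Z = X × W`, `W` abelian of dimension `m + 1`
  obtain ⟨W, hWd⟩ := exists_abelianVariety_dim_eq_succ ℂ m
  have hW : IsSmoothProjective W.dim W.X := AbelianVariety.isSmoothProjective_holds (A := W)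
  have hZ : IsSmoothProjective (n + W.dim) (X ⊗ W.X) := hX.tensor_holds hW
  obtain ⟨θZ, hθZ⟩ := exists_isPolarizationClass hZ
  have hBZ : StandardConjectureBStar (n + W.dim) (X ⊗ W.X) θZ := standardConjectureBStar_tensor_abelianVariety_of_forall hX hB W θZ
  set w₀ : ComplexPoints W.X := (1 : W.Points ℂ)
  have h1 : a + 2 * (n + W.dim) = c + 2 * n := by omega
  have h2 : c + 2 * n = a + 2 * (n + W.dim) := by omega
  -- the two retraction pairs
  set ι : complexBetti X a →ₗ[ℂ] complexBetti (X ⊗ W.X) c := complexGysin complexOrientationFamily hX hZ (sliceAt X w₀) h1 with hιdef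
  set p : complexBetti (X ⊗ W.X) c →ₗ[ℂ] complexBetti X a := complexGysin complexOrientationFamily hZ hX (fst X W.X) h2 with hpdef
  set ι' : complexBetti X c →ₗ[ℂ] complexBetti (X ⊗ W.X) c := (complexBetti.map (fst X W.X) c).hom with hι'def
  set p' : complexBetti (X ⊗ W.X) c →ₗ[ℂ] complexBetti X c := (complexBetti.map (sliceAt X w₀) c).hom with hp'def
  have algι : IsAlgebraicCorrespondence (n + W.dim) n (X ⊗ W.X) X ι :=
    isAlgebraicCorrespondence_complexGysin complexOrientationFamily hPD hX hZ (sliceAt X w₀) h1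
      (show c + (2 * (n + W.dim) - c) = 2 * (n + W.dim) by omega)
  have algp : IsAlgebraicCorrespondence n (n + W.dim) X (X ⊗ W.X) p :=
    isAlgebraicCorrespondence_complexGysin complexOrientationFamily hPD hZ hX (fst X W.X) h2 (show a + (2 * n - a) = 2 * n by omega)
  have algι' : IsAlgebraicCorrespondence (n + W.dim) n (X ⊗ W.X) X ι' := isAlgebraicCorrespondence_map hZ hX (fst X W.X) (by omega)
  have algp' : IsAlgebraicCorrespondence n (n + W.dim) X (X ⊗ W.X) p' := isAlgebraicCorrespondence_map hX hZ (sliceAt X w₀) hc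
  have hpι : ∀ v, p (ι v) = v := fun v ↦ by
    simpa only [LinearMap.comp_apply, LinearMap.id_apply] using
      LinearMap.congr_fun (complexGysin_fst_comp_complexGysin_sliceAt hX hW w₀ h1 h2) v
  have hp'ι' : ∀ w, p' (ι' w) = w := fun w ↦ by
    simpa only [LinearMap.comp_apply, LinearMap.id_apply] using LinearMap.congr_fun (map_sliceAt_comp_map_fst (X := X) w₀ c) w
  -- the semisimple operator algebra in degree `c` of `Z`
  set M : Submodule ℂ (Module.End ℂ (complexBetti (X ⊗ W.X) c)) := (algebraicClasses ((X ⊗ W.X) ⊗ (X ⊗ W.X)) (n + W.dim)).map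
    (corrAction complexOrientationFamily hZ hZ (rfl : c + 2 * (n + W.dim) = c + 2 * (n + W.dim))) with hMdef
  set R : Subalgebra ℂ (Module.End ℂ (complexBetti (X ⊗ W.X) c)) :=
    Algebra.adjoin ℂ (M : Set (Module.End ℂ (complexBetti (X ⊗ W.X) c))) with hRdef
  haveI : IsSemisimpleRing R := isSemisimpleRing_adjoin_algebraicOperators_of_standardConjectureBStar hZ hθZ hBZ c
  haveI : Module.Finite ℂ (complexBetti (X ⊗ W.X) c) := finite_complexBetti hZ c
  haveI : FiniteDimensional ℂ R := FiniteDimensional.of_injective R.val.toLinearMap Subtype.val_injective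
  have hRM : ∀ x : Module.End ℂ (complexBetti (X ⊗ W.X) c), x ∈ R ↔ x ∈ M := fun x ↦ by
    rw [← SetLike.mem_coe, hRdef, hMdef, adjoin_algebraicOperators_eq complexOrientationFamily hZ c, SetLike.mem_coe]
  have memR : ∀ U : Module.End ℂ (complexBetti (X ⊗ W.X) c),
      IsAlgebraicCorrespondence (n + W.dim) (n + W.dim) (X ⊗ W.X) (X ⊗ W.X) U → U ∈ R := fun U hU ↦ by
    obtain ⟨e, hke, Γ, hΓ, hUΓ⟩ := IsAlgebraicCorrespondence.exists_eq_corrAction hZ hZ hU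
    obtain rfl : n + W.dim = e := by omega
    exact (hRM U).mpr ⟨Γ, hΓ, hUΓ.symm⟩
  have algR : ∀ U : R, IsAlgebraicCorrespondence (n + W.dim) (n + W.dim) (X ⊗ W.X) (X ⊗ W.X)
      (U : Module.End ℂ (complexBetti (X ⊗ W.X) c)) := fun U ↦ by
    obtain ⟨Γ', hΓ', hVΓ'⟩ := (hRM _).mp U.2
    rw [← hVΓ']
    exact isAlgebraicCorrespondence_corrAction_complex hZ hZ rfl (by omega) hΓ'
  -- transports are algebraic
  have tV : ∀ {g : complexBetti X a →ₗ[ℂ] complexBetti X a}, IsAlgebraicCorrespondence n n X X g →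
      IsAlgebraicCorrespondence (n + W.dim) (n + W.dim) (X ⊗ W.X) (X ⊗ W.X) (ι ∘ₗ g ∘ₗ p) := fun hg ↦
    IsAlgebraicCorrespondence.comp hZ hX hZ (IsAlgebraicCorrespondence.comp hX hX hZ algp hg (by omega)) algι (by omega)
  have tW : ∀ {g : complexBetti X c →ₗ[ℂ] complexBetti X c}, IsAlgebraicCorrespondence n n X X g →
      IsAlgebraicCorrespondence (n + W.dim) (n + W.dim) (X ⊗ W.X) (X ⊗ W.X) (ι' ∘ₗ g ∘ₗ p') := fun hg ↦
    IsAlgebraicCorrespondence.comp hZ hX hZ (IsAlgebraicCorrespondence.comp hX hX hZ algp' hg (by omega)) algι' (by omega)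
  have tVW : ∀ {g : complexBetti X a →ₗ[ℂ] complexBetti X c}, IsAlgebraicCorrespondence n n X X g →
      IsAlgebraicCorrespondence (n + W.dim) (n + W.dim) (X ⊗ W.X) (X ⊗ W.X) (ι' ∘ₗ g ∘ₗ p) := fun hg ↦
    IsAlgebraicCorrespondence.comp hZ hX hZ (IsAlgebraicCorrespondence.comp hX hX hZ algp hg (by omega)) algι' (by omega)
  have tWV : ∀ {g : complexBetti X c →ₗ[ℂ] complexBetti X a}, IsAlgebraicCorrespondence n n X X g →
      IsAlgebraicCorrespondence (n + W.dim) (n + W.dim) (X ⊗ W.X) (X ⊗ W.X) (ι ∘ₗ g ∘ₗ p') := fun hg ↦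
    IsAlgebraicCorrespondence.comp hZ hX hZ (IsAlgebraicCorrespondence.comp hX hX hZ algp' hg (by omega)) algι (by omega)
  have algE : IsAlgebraicCorrespondence (n + W.dim) (n + W.dim) (X ⊗ W.X) (X ⊗ W.X) (ι ∘ₗ p) :=
    IsAlgebraicCorrespondence.comp hZ hX hZ algp algι (by omega)
  have algF : IsAlgebraicCorrespondence (n + W.dim) (n + W.dim) (X ⊗ W.X) (X ⊗ W.X) (ι' ∘ₗ p') :=
    IsAlgebraicCorrespondence.comp hZ hX hZ algp' algι' (by omega)
  -- the elements of `R`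
  set E : R := ⟨ι ∘ₗ p, memR _ algE⟩ with hEdef
  set E₀ : R := ⟨ι ∘ₗ e₀ ∘ₗ p, memR _ (tV alge₀)⟩ with hE₀def
  set E₂ : R := ⟨ι ∘ₗ e₂ ∘ₗ p, memR _ (tV alge₂)⟩ with hE₂def
  set F : R := ⟨ι' ∘ₗ p', memR _ algF⟩ with hFdef
  set F₀ : R := ⟨ι' ∘ₗ f₀ ∘ₗ p', memR _ (tW algf₀)⟩ with hF₀def
  set F₂ : R := ⟨ι' ∘ₗ f₂ ∘ₗ p', memR _ (tW algf₂)⟩ with hF₂def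
  set C : R := ⟨ι ∘ₗ θ ∘ₗ p', memR _ (tWV algθ)⟩ with hCdef
  set C' : R := ⟨ι' ∘ₗ Φ ∘ₗ p, memR _ (tVW algΦ)⟩ with hC'def
  set C₀ : R := ⟨ι ∘ₗ b₀ ∘ₗ p', memR _ (tWV algb₀)⟩ with hC₀def
  set C₀' : R := ⟨ι' ∘ₗ a₀ ∘ₗ p, memR _ (tVW alga₀)⟩ with hC₀'def
  set C₂ : R := ⟨ι ∘ₗ b₂ ∘ₗ p', memR _ (tWV algb₂)⟩ with hC₂def
  set C₂' : R := ⟨ι' ∘ₗ a₂ ∘ₗ p, memR _ (tVW alga₂)⟩ with hC₂'def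
  -- the identities of §1, checked on vectors (`p ι = 1`, `p' ι' = 1`)
  have iEE : E * E = E := Subtype.ext <| LinearMap.ext fun z ↦ by simp [E, Module.End.mul_apply, LinearMap.comp_apply, hpι]
  have iE₀ : E₀ * E₀ = E₀ := Subtype.ext <| LinearMap.ext fun z ↦ by
    simp [E₀, Module.End.mul_apply, LinearMap.comp_apply, hpι, he₀]
  have iE₂ : E₂ * E₂ = E₂ := Subtype.ext <| LinearMap.ext fun z ↦ by
    simp [E₂, Module.End.mul_apply, LinearMap.comp_apply, hpι, he₂]
  have iEE₀ : E * E₀ = E₀ := Subtype.ext <| LinearMap.ext fun z ↦ by simp [E, E₀, Module.End.mul_apply, LinearMap.comp_apply, hpι]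
  have iE₀E : E₀ * E = E₀ := Subtype.ext <| LinearMap.ext fun z ↦ by simp [E, E₀, Module.End.mul_apply, LinearMap.comp_apply, hpι]
  have iEE₂ : E * E₂ = E₂ := Subtype.ext <| LinearMap.ext fun z ↦ by simp [E, E₂, Module.End.mul_apply, LinearMap.comp_apply, hpι]
  have iE₂E : E₂ * E = E₂ := Subtype.ext <| LinearMap.ext fun z ↦ by simp [E, E₂, Module.End.mul_apply, LinearMap.comp_apply, hpι]
  have iE₀₂ : E₀ * E₂ = 0 := Subtype.ext <| LinearMap.ext fun z ↦ by
    simp [E₀, E₂, Module.End.mul_apply, LinearMap.comp_apply, hpι, he₀₂]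
  have iE₂₀ : E₂ * E₀ = 0 := Subtype.ext <| LinearMap.ext fun z ↦ by
    simp [E₀, E₂, Module.End.mul_apply, LinearMap.comp_apply, hpι, he₂₀]
  have iFF : F * F = F := Subtype.ext <| LinearMap.ext fun z ↦ by simp [F, Module.End.mul_apply, LinearMap.comp_apply, hp'ι']
  have iF₀ : F₀ * F₀ = F₀ := Subtype.ext <| LinearMap.ext fun z ↦ by
    simp [F₀, Module.End.mul_apply, LinearMap.comp_apply, hp'ι', hf₀]
  have iF₂ : F₂ * F₂ = F₂ := Subtype.ext <| LinearMap.ext fun z ↦ by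
    simp [F₂, Module.End.mul_apply, LinearMap.comp_apply, hp'ι', hf₂]
  have iFF₀ : F * F₀ = F₀ := Subtype.ext <| LinearMap.ext fun z ↦ by simp [F, F₀, Module.End.mul_apply, LinearMap.comp_apply, hp'ι']
  have iF₀F : F₀ * F = F₀ := Subtype.ext <| LinearMap.ext fun z ↦ by simp [F, F₀, Module.End.mul_apply, LinearMap.comp_apply, hp'ι']
  have iFF₂ : F * F₂ = F₂ := Subtype.ext <| LinearMap.ext fun z ↦ by simp [F, F₂, Module.End.mul_apply, LinearMap.comp_apply, hp'ι']
  have iF₂F : F₂ * F = F₂ := Subtype.ext <| LinearMap.ext fun z ↦ by simp [F, F₂, Module.End.mul_apply, LinearMap.comp_apply, hp'ι']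
  have iF₀₂ : F₀ * F₂ = 0 := Subtype.ext <| LinearMap.ext fun z ↦ by
    simp [F₀, F₂, Module.End.mul_apply, LinearMap.comp_apply, hp'ι', hf₀₂]
  have iF₂₀ : F₂ * F₀ = 0 := Subtype.ext <| LinearMap.ext fun z ↦ by
    simp [F₀, F₂, Module.End.mul_apply, LinearMap.comp_apply, hp'ι', hf₂₀]
  obtain ⟨x, y, hx, -, -, hyx⟩ := exists_equivalent_middle_of_traces (k := ℂ) (A := R) iEE iE₀ iE₂ iEE₀ iE₀E iEE₂ iE₂E iE₀₂ iE₂₀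
    iFF iF₀ iF₂ iFF₀ iF₀F iFF₂ iF₂F iF₀₂ iF₂₀
    ⟨C, C', Subtype.ext <| LinearMap.ext fun z ↦ by simp [E, F, C, Module.End.mul_apply, LinearMap.comp_apply, hpι, hp'ι'],
      Subtype.ext <| LinearMap.ext fun z ↦ by simp [E, F, C', Module.End.mul_apply, LinearMap.comp_apply, hpι, hp'ι'],
      Subtype.ext <| LinearMap.ext fun z ↦ by simp [E, C, C', Module.End.mul_apply, LinearMap.comp_apply, hp'ι', hθΦ],
      Subtype.ext <| LinearMap.ext fun z ↦ by simp [F, C, C', Module.End.mul_apply, LinearMap.comp_apply, hpι, hΦθ]⟩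
    ⟨C₀, C₀', Subtype.ext <| LinearMap.ext fun z ↦ by simp [E₀, F₂, C₀, Module.End.mul_apply, LinearMap.comp_apply, hpι, hp'ι', hb₀],
      Subtype.ext <| LinearMap.ext fun z ↦ by simp [E₀, F₂, C₀', Module.End.mul_apply, LinearMap.comp_apply, hpι, hp'ι', ha₀],
      Subtype.ext <| LinearMap.ext fun z ↦ by simp [E₀, C₀, C₀', Module.End.mul_apply, LinearMap.comp_apply, hp'ι', hba₀],
      Subtype.ext <| LinearMap.ext fun z ↦ by simp [F₂, C₀, C₀', Module.End.mul_apply, LinearMap.comp_apply, hpι, hab₀]⟩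
    ⟨C₂, C₂', Subtype.ext <| LinearMap.ext fun z ↦ by simp [E₂, F₀, C₂, Module.End.mul_apply, LinearMap.comp_apply, hpι, hp'ι', hb₂],
      Subtype.ext <| LinearMap.ext fun z ↦ by simp [E₂, F₀, C₂', Module.End.mul_apply, LinearMap.comp_apply, hpι, hp'ι', ha₂],
      Subtype.ext <| LinearMap.ext fun z ↦ by simp [E₂, C₂, C₂', Module.End.mul_apply, LinearMap.comp_apply, hp'ι', hba₂],
      Subtype.ext <| LinearMap.ext fun z ↦ by simp [F₀, C₂, C₂', Module.End.mul_apply, LinearMap.comp_apply, hpι, hab₂]⟩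
  -- read the two conclusions on vectors (no algebra inside the subtype `R`)
  set ξ : Module.End ℂ (complexBetti (X ⊗ W.X) c) := (x : Module.End ℂ (complexBetti (X ⊗ W.X) c)) with hξ
  have cE₁ : ∀ u, ((E - E₀ - E₂ : R) : Module.End ℂ (complexBetti (X ⊗ W.X) c)) u = ι (p u) - ι (e₀ (p u)) - ι (e₂ (p u)) :=
    fun u ↦ by
    simp only [Subalgebra.coe_sub, LinearMap.sub_apply]
    rfl
  have cF₁ : ∀ z, ((F - F₀ - F₂ : R) : Module.End ℂ (complexBetti (X ⊗ W.X) c)) z =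
      ι' (p' z) - ι' (f₀ (p' z)) - ι' (f₂ (p' z)) := fun z ↦ by
    simp only [Subalgebra.coe_sub, LinearMap.sub_apply]
    rfl
  have hxz : ∀ z, ξ z = ι (p (ξ (ι' (p' z) - ι' (f₀ (p' z)) - ι' (f₂ (p' z))))) -
      ι (e₀ (p (ξ (ι' (p' z) - ι' (f₀ (p' z)) - ι' (f₂ (p' z)))))) - ι (e₂ (p (ξ (ι' (p' z) - ι' (f₀ (p' z)) - ι' (f₂ (p' z)))))) :=
    fun z ↦ by
    have h := congrArg (fun T : R ↦ (T : Module.End ℂ (complexBetti (X ⊗ W.X) c)) z) hx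
    simp only [Subalgebra.coe_mul, Module.End.mul_apply] at h
    rw [cF₁, cE₁] at h
    exact h.symm
  have hyxz : ∀ w, (y : Module.End ℂ (complexBetti (X ⊗ W.X) c)) (ξ (ι' w)) = ι' w - ι' (f₀ w) - ι' (f₂ w) := fun w ↦ by
    have h := congrArg (fun T : R ↦ (T : Module.End ℂ (complexBetti (X ⊗ W.X) c)) (ι' w)) hyx
    simp only [Subalgebra.coe_mul, Module.End.mul_apply] at h
    rw [cF₁, hp'ι'] at h
    exact h
  have vE₀x : ∀ z, e₀ (p (ξ z)) = 0 := fun z ↦ by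
    rw [hxz z]
    simp only [map_sub, hpι, he₀, he₀₂, sub_self]
  have vE₂x : ∀ z, e₂ (p (ξ z)) = 0 := fun z ↦ by
    rw [hxz z]
    simp only [map_sub, hpι, he₂, he₂₀, sub_self, sub_zero]
  have vEx : ∀ z, ι (p (ξ z)) = ξ z := fun z ↦ by
    rw [hxz z]
    simp only [map_sub, hpι]
  have vxF₀ : ∀ w, ξ (ι' (f₀ w)) = 0 := fun w ↦ by
    rw [hxz]
    simp only [hp'ι', hf₀, hf₂₀, sub_self, map_zero]
  have vxF₂ : ∀ w, ξ (ι' (f₂ w)) = 0 := fun w ↦ by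
    rw [hxz]
    simp only [hp'ι', hf₂, hf₀₂, sub_self, map_zero, sub_zero]
  -- the correspondence `x := pr_{X*} ∘ ξ ∘ pr_X^*`
  refine ⟨p ∘ₗ ξ ∘ₗ ι', ?_, fun w ↦ vE₀x _, fun w ↦ vE₂x _, fun w ↦ ?_, fun w ↦ ?_, fun w hw₀ hw₂ hw ↦ ?_⟩
  · exact IsAlgebraicCorrespondence.comp hX hZ hX (IsAlgebraicCorrespondence.comp hZ hZ hX algι' (algR x) (by omega)) algp
      (by omega)
  · simp only [LinearMap.comp_apply, vxF₀, map_zero]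
  · simp only [LinearMap.comp_apply, vxF₂, map_zero]
  · have h1 : ξ (ι' w) = 0 := by
      rw [← vEx]
      simp only [LinearMap.comp_apply] at hw
      rw [hw, map_zero]
    have h2 := hyxz w
    rw [h1, map_zero, hw₀, hw₂, map_zero, sub_zero, sub_zero] at h2
    rw [← hp'ι' w, ← h2, map_zero]

end Corner

end Summit.HodgeConjecture.HodgeConjecture.Theorems

end
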